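import Summits.QuantumFields.BalabanUV.T4Continuum.Spine.NE1p.B7AveragingLevelsCurvedBackground
import Literature.MathematicalPhysics.QuantumFieldTheory.Balaban1983to89.B7LocalityGeneral

/-!
# T⁴ programme, spine estimate NE1′ (node O3b/H2) — DOOR (c) AT EVERY LEVEL `j ≤ k` FOR THE PRINTED `Q_j` (127), BLOCK-PAIR-LOCALLY:
# file 19's estimates with EVERY hypothesis on the background and on the fields placed on the bonds of `B^j(c₋) ∪ B^j(c₊)` only —
# the background's (52) in the PRINTED local currency `sup_{p ⊂ B^j(c₋)∪B^j(c₊)} |U₀(∂p) − 1| < α₀η²` (`B7Prop1Local.pdevOn`)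

Cell `pub-balaban-gaps` (YM blitz Y1, track G2), seat `ne1` gen 11 session 3 (prover-pub-balaban-gaps-ne1-g11-0); record `HOME/ne/NE1.md`
§4 R66.  ADDITIVE — imports this seat's file 19 `B7AveragingLevelsCurvedBackground` (`norm_levels_curvature_sub_le`,
`norm_levels_curvature_le_of_bound`, `norm_levels_curvature_le_of_commute`: the quadratic term of the printed composite `Q_j(e^{B}U₀, τA)(c)`
is Lipschitz in the background across Proposition 7's ball, from the lineage's kernel Prop. 7 + two-parameter Cauchy) and the r20 lineage's
`B7LocalityGeneral` (KERNEL LOCALITY OF THE COMPOSITE (127): `logCovIter_congr` — «`Q_j(U₀, B)(c)` depends only on the bond variables of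
`U₀` AND of `B` in `B^j(c₋) ∪ B^j(c₊)`», p. 24 ∕ p. 31 ∕ p. 34; `agreeOn_mul`) BY NAME, with the b07 lineage's `B7Prop1Local` (boxes
`loK`∕`bondHiK`, `AgreeOn`, the clamped extension `clampCfg` ∕ `clampCfg_agree` ∕ `clampCfg_mem`, the local plaquette deviation `pdevOn` and
`pdev_clampCfg_le`) and `B7Prop5Flat.agreeOn_expCfg`; nothing edited or restated; 0 def.

PRINT.  [Balaban1985Averaging] p. 24 (after (43)): «this definition is local in the sense that `Ū^k_c`, `c ⊂ Ω^{(k)}`, depends only on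
the bond variables `U_b` for `b ⊂ B^k(c₋) ∪ B^k(c₊)`.  This property will play a very important role in the future.»; p. 26 (after (54)):
«The result is local in the sense that … it is enough to assume (52) for `p ⊂ B^k(x) ∪ …`»; p. 34: `Q(V₀, A, c)` is «an analytic function of
the variables `A_b`, `b ⊂ B(c₋) ∪ B(c₊)`»; (127) p. 37; Proposition 7 p. 43.  File 19 carries Prop. 7's GLOBAL hypotheses (`U₀(b) ∈ G`
and (52) `pdev U₀ < α₀η²` on all of `ℤᵈ`; `sup‖A‖ ≤ a`, `sup‖B‖ ≤ b`); THIS file moves every smallness hypothesis onto the block pair.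

WHAT THIS FILE PROVES ([folklore] truncation∕clamping bookkeeping on the lineage's kernel locality; 0 sorry):
* §1 **`logCovIter_background_slot_congr`** — `Q_j(e^{sB}U₀, τA)(c)` is unchanged when `U₀`, `A`, `B` are replaced by
  anything agreeing with them on the bonds of `B^j(c₋) ∪ B^j(c₊) = [Lʲz, Lʲz + (Lʲ − 1)𝟙 + Lʲe_κ]` (`logCovIter_congr` + `agreeOn_mul` +
  `agreeOn_expCfg`), `iteratedDeriv_two_logCovIter_congr` (hence so is its quadratic term in `τ`).
* §2 **`norm_levels_curvature_sub_le_local`** — for a `G`-valued background `U₀` with **(52) ON THE BLOCK PAIR ONLY,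
  `pdevOn (loK L j z) (bondHiK L j z κ) U₀ < α₀η²`**, and fields with `‖A(b)‖ ≤ a`, `‖B(b)‖ ≤ b` for the bonds `b` of the block pair only
  (`0 < a`, `0 < b`, `2b ≤ β′`), `j ≤ k`: `‖∂_τ²|₀ Q_j(e^{B}U₀, τA)(c) − ∂_τ²|₀ Q_j(U₀, τA)(c)‖ ≤ 8·Lʲ·a²·b∕(β·β′)` — file 19's
  `norm_levels_curvature_sub_le` applied to the CLAMPED background `π^*U₀` (`G`-valued, (52) globally by `pdev_clampCfg_le`) and the
  TRUNCATED fields, which agree with the originals on the block pair; **`norm_levels_curvature_le_of_bound_local`** (`≤ 4Lʲa²∕β`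
  likewise); **`norm_levels_curvature_le_of_commute_local`** — for ANY background `U₀` FLAT ON THE BLOCK PAIR (`U₀(b) = 1` for its bonds),
  any `B` with `‖B(b)‖ ≤ b` there and any slot `A` with `‖A(b)‖ ≤ a` and pairwise commuting values there (every one-parameter slot):
  `‖∂_τ²|₀ Q_j(e^{B}U₀, τA)(c)‖ ≤ 8·Lʲ·a²·b∕(β·β′)` — «DIAGONAL CURVATURE ∝ NON-FLATNESS» AT EVERY LEVEL, BLOCK-PAIR-LOCALLY.
What it does NOT do: the generator-free form at level `j` (non-flatness = `pdevOn` itself, via gauge covariance of `Q_j` + a level-`j` axial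
gauge — file 18 is level 1 for the ratio (65)); optimal constants; NODE O.  The Prop.-7 regime data (`L ≥ 2`, `AvgClosed d L G`, `0 < α₀`,
`C₀α₀ ≤ 1∕3`, `8α₀ ≤ c₂′`, the displayed `hsmall′ ∕ hc₃′ ∕ hb′1 ∕ hsmall ∕ hc₃` at budgets `β′`, `β`) stay verbatim hypotheses.

HONEST FRAMING.  [folklore] bookkeeping riding on the lineage's kernel Propositions 4∕7 and kernel locality over its verbatim ℤᵈ model;
nothing of Bałaban's asserted beyond print; NE1′ NOT proved; spine 0∕9; (B) 0∕13; binders 0∕6; one finite T⁴ — NOT ℝ⁴, NOT infinite volume,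
NOT a mass gap, NOT Clay.
-/

noncomputable section

open scoped Topology
open NormedSpace Filter Metric Set

namespace Summit.QuantumFields.BalabanUV.T4Continuum.NE1p.B7AveragingCommutator

open Literature.MathematicalPhysics.QuantumFieldTheory.Balaban1983to89.B7Prop1Explicit
open Literature.MathematicalPhysics.QuantumFieldTheory.Balaban1983to89.B7Prop1Local (InBox AgreeOn loK bondHiK clampCfg clampCfg_agree
  clampCfg_mem pdevOn pdev_clampCfg_le add_e_apply)
open Literature.MathematicalPhysics.QuantumFieldTheory.Balaban1983to89.B7Prop2Explicit (avgIter pdev C0 c2' AvgClosed)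
open Literature.MathematicalPhysics.QuantumFieldTheory.Balaban1983to89.B7Prop3Flat (expCfg c3)
open Literature.MathematicalPhysics.QuantumFieldTheory.Balaban1983to89.B7Prop4GeneralLevels (logCovIter)
open Literature.MathematicalPhysics.QuantumFieldTheory.Balaban1983to89.B7Prop5Flat (agreeOn_expCfg)
open Literature.MathematicalPhysics.QuantumFieldTheory.Balaban1983to89.B7LocalityGeneral (agreeOn_mul logCovIter_congr)

variable {d : ℕ} {𝔸 : Type*} [NormedRing 𝔸] [NormedAlgebra ℂ 𝔸] [CompleteSpace 𝔸] [NormOneClass 𝔸]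

/-! ## §1 Locality of `Q_j(e^{sB}U₀, τA)(c)` and of its quadratic term -/

section Locality

variable (L : ℕ)

omit [NormOneClass 𝔸] in
/-- **LOCALITY OF `Q_j(e^{sB}U₀, τA)(c)`** (the lineage's kernel `logCovIter_congr`, p. 24 ∕ p. 31 ∕ p. 34): backgrounds `U₀ ≡ U₀′`,
background generators `B ≡ B′` and slots `A ≡ A′` on the bonds of `B^j(c₋) ∪ B^j(c₊)`, `c = ⟨z, z + e_κ⟩` of the `j`-th lattice, give the
same `Q_j(e^{sB}U₀, τA)(c)`. [cite: Balaban1985Averaging, p.24 (sentence after (43)), (127) p.37, p.34] -/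
theorem logCovIter_background_slot_congr (hL : 1 ≤ L) (j : ℕ) (z : Site d) (κ : Fin d)
    {U₀ U₀' : Site d → Fin d → 𝔸ˣ} {A A' B B' : Site d → Fin d → 𝔸}
    (hU : AgreeOn (loK L j z) (bondHiK L j z κ) U₀ U₀') (hA : AgreeOn (loK L j z) (bondHiK L j z κ) A A')
    (hB : AgreeOn (loK L j z) (bondHiK L j z κ) B B') (s τ : ℂ) :
    logCovIter L (expCfg (s • B) * U₀) (τ • A) j z κ = logCovIter L (expCfg (s • B') * U₀') (τ • A') j z κ :=
  logCovIter_congr L hL j z κ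
    (agreeOn_mul (agreeOn_expCfg fun x μ hx hxe => by simp only [Pi.smul_apply, hB x μ hx hxe]) hU)
    fun x μ hx hxe => by simp only [Pi.smul_apply, hA x μ hx hxe]

omit [NormOneClass 𝔸] in
/-- … hence the same quadratic term in the slot amplitude. [cite: Balaban1985Averaging, p.24 (sentence after (43)), (127) p.37] -/
theorem iteratedDeriv_two_logCovIter_congr (hL : 1 ≤ L) (j : ℕ) (z : Site d) (κ : Fin d)
    {U₀ U₀' : Site d → Fin d → 𝔸ˣ} {A A' B B' : Site d → Fin d → 𝔸}
    (hU : AgreeOn (loK L j z) (bondHiK L j z κ) U₀ U₀') (hA : AgreeOn (loK L j z) (bondHiK L j z κ) A A')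
    (hB : AgreeOn (loK L j z) (bondHiK L j z κ) B B') (s : ℂ) :
    iteratedDeriv 2 (fun τ : ℂ => logCovIter L (expCfg (s • B) * U₀) (τ • A) j z κ) 0
      = iteratedDeriv 2 (fun τ : ℂ => logCovIter L (expCfg (s • B') * U₀') (τ • A') j z κ) 0 := by
  rw [show (fun τ : ℂ => logCovIter L (expCfg (s • B) * U₀) (τ • A) j z κ)
      = fun τ : ℂ => logCovIter L (expCfg (s • B') * U₀') (τ • A') j z κ from
    funext fun τ => logCovIter_background_slot_congr L hL j z κ hU hA hB s τ]

end Locality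

/-! ## §2 File 19 with every hypothesis on the block pair -/

section Local

variable (L : ℕ) (hL : 2 ≤ L) {G : Subgroup 𝔸ˣ} (hG : AvgClosed d L G) (k : ℕ) {α₀ : ℝ} (hα : 0 < α₀)
  (hα3 : C0 d * α₀ ≤ 1 / 3) (hα8 : 8 * α₀ ≤ c2' d L)
  {β β' : ℝ} (hβ : 0 < β) (hβ' : 0 < β')
  (hsmall' : Real.exp (4 * (800 * ((d : ℝ) + 1) ^ 2 * ((d : ℝ) + 4)) * α₀)
    * (1 + 8 * (131072 * ((d : ℝ) + 1) ^ 2) * ((L : ℝ) ^ k * β')) ≤ 2)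
  (hc₃' : 2 * ((L : ℝ) ^ k * β') ≤ c3 d L) (hb'1 : 409600 * ((d : ℝ) + 1) ^ 2 * ((L : ℝ) ^ k * β') ≤ 1)
  (hsmall : Real.exp (4480 * ((d : ℝ) + 1) ^ 2 * ((d : ℝ) + 4) * α₀ + 240000 * ((d : ℝ) + 1) ^ 3 * ((L : ℝ) ^ k * β'))
    * (1 + 8 * (2097152 * ((d : ℝ) + 1) ^ 2) * ((L : ℝ) ^ k * β)) ≤ 2)
  (hc₃ : 2 * ((L : ℝ) ^ k * β) ≤ c3 d L / 4)
  {A B : Site d → Fin d → 𝔸} {a b : ℝ} (ha0 : 0 < a) (hb0 : 0 < b)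

include hL hG hα hα3 hα8 hβ hβ' hsmall' hc₃' hb'1 hsmall hc₃ ha0 hb0 in
/-- **THE QUADRATIC TERM OF `Q_j` IS LIPSCHITZ IN THE BACKGROUND, BLOCK-PAIR-LOCALLY**: for a `G`-valued background `U₀` with (52) ON THE
BLOCK PAIR ONLY — `pdevOn (loK L j z) (bondHiK L j z κ) U₀ < α₀η²` —, `‖A(b)‖ ≤ a` and `‖B(b)‖ ≤ b` for the bonds `b` of the block pair
(`0 < a`, `0 < b`, `2b ≤ β′`), `j ≤ k`: `‖∂_τ²|₀ Q_j(e^{B}U₀, τA)(c) − ∂_τ²|₀ Q_j(U₀, τA)(c)‖ ≤ 8·Lʲ·a²·b∕(β·β′)` — file 19 for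
the clamped background `π^*U₀` (`G`-valued, (52) on all of `ℤᵈ` by `pdev_clampCfg_le`) and the truncated fields, all agreeing with the
originals on the block pair (§1). [cite: Balaban1985Averaging, Proposition 7 p.43, (127) p.37, p.24 (after (43)), p.26 (after (54))] -/
theorem norm_levels_curvature_sub_le_local (U₀ : Site d → Fin d → 𝔸ˣ) (hU₀ : ∀ x μ, U₀ x μ ∈ G) {j : ℕ} (hj : j ≤ k)
    (z : Site d) (κ : Fin d) (h52 : pdevOn (loK L j z) (bondHiK L j z κ) U₀ < α₀ * (((L : ℝ) ^ k)⁻¹) ^ 2)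
    (ha : ∀ (x : Site d) (μ : Fin d), InBox (loK L j z) (bondHiK L j z κ) x → InBox (loK L j z) (bondHiK L j z κ) (x + e μ) →
      ‖A x μ‖ ≤ a)
    (hb : ∀ (x : Site d) (μ : Fin d), InBox (loK L j z) (bondHiK L j z κ) x → InBox (loK L j z) (bondHiK L j z κ) (x + e μ) →
      ‖B x μ‖ ≤ b)
    (hbβ : 2 * b ≤ β') :
    ‖iteratedDeriv 2 (fun τ : ℂ => logCovIter L (expCfg ((1 : ℂ) • B) * U₀) (τ • A) j z κ) 0
        - iteratedDeriv 2 (fun τ : ℂ => logCovIter L (expCfg ((0 : ℂ) • B) * U₀) (τ • A) j z κ) 0‖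
      ≤ 8 * (L : ℝ) ^ j * a ^ 2 * b / (β * β') := by
  classical
  have hL1 : 1 ≤ L := le_trans (by norm_num) hL
  set lo := loK L j z with hlo
  set hi := bondHiK L j z κ with hhi
  let At : Site d → Fin d → 𝔸 := fun x μ => if InBox lo hi x ∧ InBox lo hi (x + e μ) then A x μ else 0
  let Bt : Site d → Fin d → 𝔸 := fun x μ => if InBox lo hi x ∧ InBox lo hi (x + e μ) then B x μ else 0
  have hAt : AgreeOn lo hi A At := fun x μ hx hxe => by simp only [At, hx, hxe, and_self, if_true]
  have hBt : AgreeOn lo hi B Bt := fun x μ hx hxe => by simp only [Bt, hx, hxe, and_self, if_true]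
  have hat : ∀ (x : Site d) (μ : Fin d), ‖At x μ‖ ≤ a := fun x μ => by
    simp only [At]; split_ifs with h
    exacts [ha x μ h.1 h.2, by rw [norm_zero]; exact ha0.le]
  have hbt : ∀ (x : Site d) (μ : Fin d), ‖Bt x μ‖ ≤ b := fun x μ => by
    simp only [Bt]; split_ifs with h
    exacts [hb x μ h.1 h.2, by rw [norm_zero]; exact hb0.le]
  have hUt : AgreeOn lo hi U₀ (clampCfg lo hi U₀) := (clampCfg_agree U₀).symm
  have hUtG : ∀ x μ, clampCfg lo hi U₀ x μ ∈ G := clampCfg_mem hU₀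
  have hlohi : ∀ i, lo i ≤ hi i := fun i => by
    have hP : (1 : ℤ) ≤ (L : ℤ) ^ j := one_le_pow₀ (by exact_mod_cast hL1)
    simp only [hlo, hhi, loK, bondHiK]
    split_ifs <;> linarith
  have h52t : pdev (clampCfg lo hi U₀) < α₀ * (((L : ℝ) ^ k)⁻¹) ^ 2 :=
    (pdev_clampCfg_le hlohi (fun x μ => hG.le_U1 (hU₀ x μ))).trans_lt h52
  rw [iteratedDeriv_two_logCovIter_congr L hL1 j z κ hUt hAt hBt, iteratedDeriv_two_logCovIter_congr L hL1 j z κ hUt hAt hBt]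
  exact norm_levels_curvature_sub_le L hL hG k hα hα3 hα8 hβ hβ' hsmall' hc₃' hb'1 hsmall hc₃ ha0 hb0 hat hbt
    (clampCfg lo hi U₀) hUtG h52t hbβ hj z κ

include hL hG hα hα3 hα8 hβ hβ' hsmall' hc₃' hb'1 hsmall hc₃ ha0 hb0 in
/-- **The uniform second-order bound, block-pair-locally**: under the same local hypotheses and `‖s‖·b ≤ β′`,
`‖∂_τ²|₀ Q_j(e^{sB}U₀, τA)(c)‖ ≤ 4·Lʲ·a²∕β`. [cite: Balaban1985Averaging, Proposition 7 p.43, (131) p.38, p.24 (after (43))] -/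
theorem norm_levels_curvature_le_of_bound_local (U₀ : Site d → Fin d → 𝔸ˣ) (hU₀ : ∀ x μ, U₀ x μ ∈ G) {j : ℕ} (hj : j ≤ k)
    (z : Site d) (κ : Fin d) (h52 : pdevOn (loK L j z) (bondHiK L j z κ) U₀ < α₀ * (((L : ℝ) ^ k)⁻¹) ^ 2)
    (ha : ∀ (x : Site d) (μ : Fin d), InBox (loK L j z) (bondHiK L j z κ) x → InBox (loK L j z) (bondHiK L j z κ) (x + e μ) →
      ‖A x μ‖ ≤ a)
    (hb : ∀ (x : Site d) (μ : Fin d), InBox (loK L j z) (bondHiK L j z κ) x → InBox (loK L j z) (bondHiK L j z κ) (x + e μ) →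
      ‖B x μ‖ ≤ b)
    {s : ℂ} (hs : ‖s‖ * b ≤ β') :
    ‖iteratedDeriv 2 (fun τ : ℂ => logCovIter L (expCfg (s • B) * U₀) (τ • A) j z κ) 0‖ ≤ 4 * (L : ℝ) ^ j * a ^ 2 / β := by
  classical
  have hL1 : 1 ≤ L := le_trans (by norm_num) hL
  set lo := loK L j z with hlo
  set hi := bondHiK L j z κ with hhi
  let At : Site d → Fin d → 𝔸 := fun x μ => if InBox lo hi x ∧ InBox lo hi (x + e μ) then A x μ else 0
  let Bt : Site d → Fin d → 𝔸 := fun x μ => if InBox lo hi x ∧ InBox lo hi (x + e μ) then B x μ else 0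
  have hAt : AgreeOn lo hi A At := fun x μ hx hxe => by simp only [At, hx, hxe, and_self, if_true]
  have hBt : AgreeOn lo hi B Bt := fun x μ hx hxe => by simp only [Bt, hx, hxe, and_self, if_true]
  have hat : ∀ (x : Site d) (μ : Fin d), ‖At x μ‖ ≤ a := fun x μ => by
    simp only [At]; split_ifs with h
    exacts [ha x μ h.1 h.2, by rw [norm_zero]; exact ha0.le]
  have hbt : ∀ (x : Site d) (μ : Fin d), ‖Bt x μ‖ ≤ b := fun x μ => by
    simp only [Bt]; split_ifs with h
    exacts [hb x μ h.1 h.2, by rw [norm_zero]; exact hb0.le]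
  have hUt : AgreeOn lo hi U₀ (clampCfg lo hi U₀) := (clampCfg_agree U₀).symm
  have hUtG : ∀ x μ, clampCfg lo hi U₀ x μ ∈ G := clampCfg_mem hU₀
  have hlohi : ∀ i, lo i ≤ hi i := fun i => by
    have hP : (1 : ℤ) ≤ (L : ℤ) ^ j := one_le_pow₀ (by exact_mod_cast hL1)
    simp only [hlo, hhi, loK, bondHiK]
    split_ifs <;> linarith
  have h52t : pdev (clampCfg lo hi U₀) < α₀ * (((L : ℝ) ^ k)⁻¹) ^ 2 :=
    (pdev_clampCfg_le hlohi (fun x μ => hG.le_U1 (hU₀ x μ))).trans_lt h52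
  rw [iteratedDeriv_two_logCovIter_congr L hL1 j z κ hUt hAt hBt]
  exact norm_levels_curvature_le_of_bound L hL hG k hα hα3 hα8 hβ hβ' hsmall' hc₃' hb'1 hsmall hc₃ ha0 hat hbt
    (clampCfg lo hi U₀) hUtG h52t hs hj z κ

include hL hG hα hα3 hα8 hβ hβ' hsmall' hc₃' hb'1 hsmall hc₃ ha0 hb0 in
/-- **«DIAGONAL CURVATURE ∝ NON-FLATNESS» AT EVERY LEVEL `j ≤ k`, BLOCK-PAIR-LOCALLY**: for ANY background `U₀` that is FLAT ON THE BLOCK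
PAIR (`U₀(b) = 1` for the bonds `b` of `B^j(c₋) ∪ B^j(c₊)`), any `B` with `‖B(b)‖ ≤ b` there (`0 < b`, `2b ≤ β′`) and any slot `A` with
`‖A(b)‖ ≤ a` there (`0 < a`) whose values on those bonds pairwise commute (every one-parameter slot), `j ≤ k`:
`‖∂_τ²|₀ Q_j(e^{B}U₀, τA)(c)‖ ≤ 8·Lʲ·a²·b∕(β·β′)` — zero at backgrounds flat on the block pair, linear in the size of the background
generator there. [cite: Balaban1985Averaging, Proposition 7 p.43, (131)∕(134) p.38, (127) p.37, p.24 (after (43))] -/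
theorem norm_levels_curvature_le_of_commute_local (U₀ : Site d → Fin d → 𝔸ˣ) {j : ℕ} (hj : j ≤ k) (z : Site d) (κ : Fin d)
    (hU₀ : AgreeOn (loK L j z) (bondHiK L j z κ) U₀ 1)
    (ha : ∀ (x : Site d) (μ : Fin d), InBox (loK L j z) (bondHiK L j z κ) x → InBox (loK L j z) (bondHiK L j z κ) (x + e μ) →
      ‖A x μ‖ ≤ a)
    (hb : ∀ (x : Site d) (μ : Fin d), InBox (loK L j z) (bondHiK L j z κ) x → InBox (loK L j z) (bondHiK L j z κ) (x + e μ) →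
      ‖B x μ‖ ≤ b)
    (hbβ : 2 * b ≤ β')
    (hA : ∀ (x : Site d) (μ : Fin d) (y : Site d) (ν : Fin d), InBox (loK L j z) (bondHiK L j z κ) x →
      InBox (loK L j z) (bondHiK L j z κ) (x + e μ) → InBox (loK L j z) (bondHiK L j z κ) y →
      InBox (loK L j z) (bondHiK L j z κ) (y + e ν) → Commute (A x μ) (A y ν)) :
    ‖iteratedDeriv 2 (fun τ : ℂ => logCovIter L (expCfg B * U₀) (τ • A) j z κ) 0‖ ≤ 8 * (L : ℝ) ^ j * a ^ 2 * b / (β * β') := by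
  classical
  have hL1 : 1 ≤ L := le_trans (by norm_num) hL
  set lo := loK L j z with hlo
  set hi := bondHiK L j z κ with hhi
  let At : Site d → Fin d → 𝔸 := fun x μ => if InBox lo hi x ∧ InBox lo hi (x + e μ) then A x μ else 0
  let Bt : Site d → Fin d → 𝔸 := fun x μ => if InBox lo hi x ∧ InBox lo hi (x + e μ) then B x μ else 0
  have hAt : AgreeOn lo hi A At := fun x μ hx hxe => by simp only [At, hx, hxe, and_self, if_true]
  have hBt : AgreeOn lo hi B Bt := fun x μ hx hxe => by simp only [Bt, hx, hxe, and_self, if_true]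
  have hat : ∀ (x : Site d) (μ : Fin d), ‖At x μ‖ ≤ a := fun x μ => by
    simp only [At]; split_ifs with h
    exacts [ha x μ h.1 h.2, by rw [norm_zero]; exact ha0.le]
  have hbt : ∀ (x : Site d) (μ : Fin d), ‖Bt x μ‖ ≤ b := fun x μ => by
    simp only [Bt]; split_ifs with h
    exacts [hb x μ h.1 h.2, by rw [norm_zero]; exact hb0.le]
  have hAc : ∀ (x : Site d) (μ : Fin d) (y : Site d) (ν : Fin d), Commute (At x μ) (At y ν) := fun x μ y ν => by
    simp only [At]; split_ifs with h1 h2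
    exacts [hA x μ y ν h1.1 h1.2 h2.1 h2.2, Commute.zero_right _, Commute.zero_left _, Commute.zero_left _]
  have h1 : iteratedDeriv 2 (fun τ : ℂ => logCovIter L (expCfg B * U₀) (τ • A) j z κ) 0
      = iteratedDeriv 2 (fun τ : ℂ => logCovIter L (expCfg Bt * 1) (τ • At) j z κ) 0 := by
    have := iteratedDeriv_two_logCovIter_congr L hL1 j z κ hU₀ hAt hBt 1
    simpa only [one_smul] using this
  rw [h1]
  exact norm_levels_curvature_le_of_commute L hL hG k hα hα3 hα8 hβ hβ' hsmall' hc₃' hb'1 hsmall hc₃ ha0 hb0 hat hbt hbβ hAc hj z κ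

end Local

end Summit.QuantumFields.BalabanUV.T4Continuum.NE1p.B7AveragingCommutator

end
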